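/-
Copyright: lit-balaban Phase-2 proof seat p33 (gen 8).  Statement-level skeleton of a published paper; no proof claims beyond what
the kernel checks below.
-/
import Literature.MathematicalPhysics.QuantumFieldTheory.BalabanImbrieJaffe1984to88.BIJ85AgmonDefect
import Literature.MathematicalPhysics.QuantumFieldTheory.BalabanImbrieJaffe1984to88.BIJ85Ineq732General
import Literature.MathematicalPhysics.QuantumFieldTheory.BalabanImbrieJaffe1984to88.BIJ85BlockKPoincare
import Literature.MathematicalPhysics.QuantumFieldTheory.BalabanImbrieJaffe1984to88.BIJ85Ineq722Torus

/-!
# [BalabanImbrieJaffe1985] §7.3: EXPONENTIAL DECAY OF THE SCALAR PROPAGATOR `G_k(u) = [D_u^*D_u + aQ_k(u)^*Q_k(u)]⁻¹` ON THE TORUS,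
# uniformly in the scale and the volume (kernel file 2 of 3: coercivity, the Agmon weighted bound, the decay of the pairing)

T. Bałaban, J. Imbrie, A. Jaffe, *Renormalization of the Higgs model: minimizers, propagators and the stability of mean field theory*,
Commun. Math. Phys. **97** (1985) 299–329 [BalabanImbrieJaffe1985].  Row **C1.Eq7.3.1-7.3.2** of the lit-balaban skeleton (owner r15),
the p. 326 sentence on the scalar propagators — its DECAY member.

statement-level skeleton of published theorems with citation tags; proofs where landed; nothing here is a claim about the Yang–Mills mass gap

PDF held: `paper:balaban1985-cmp97-bij-higgs-minimizers` (p. 326 = PDF 28; p. 313 = PDF 15); text layer re-read this session.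

THE PRINTED TEXT, verbatim, p. 326 [PDF 28]: *"The propagators arising from Δ_k(u_k), under the restriction (7.3.1) on the gauge field, also
satisfy the regularity and decay estimates of [7]."* ([7] = [Balaban1983RegularityDecay], cell paper B4; its decay statement for these
propagators is Cor. 2.3 (2.30) p. 580: `|⟨f, G_k(Ω,A)f′⟩| ≤ c₀e^{−δ₀dist(supp f, supp f′)}‖f‖₂‖f′‖₂`, *"for e sufficiently small"*); p. 313
[PDF 15]: *"G_k(u_k) = [−Δ_{u_k} + a_kQ_k^*(u_k)Q_k(u_k)]^{−1}, (4.6.2) where −Δ_{u_k} = D^*_{u_k}D_{u_k}. (4.6.3)"*.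

THE ARGUMENT (energy / Agmon–Combes–Thomas conjugation; DIVERGENCE OF METHOD from [7]'s random-walk route, disclosed — same SHAPE of
statement).  `T = D_u^*D_u + aQ_k(u)^*Q_k(u)` (p30/p11's `opT (Dlin c U) (QlinK U k) a` on `FineSp`), `G` any right inverse (`exists_GK`).
(i) COERCIVITY `m₀‖φ‖² ≤ ⟨φ, Tφ⟩`, `m₀ = min(a/2, c²N/(4n²))/N` (`n = L^k`, `N = L^{kd}`), for EVERY `U(1)` field whose η-plaquette variables
obey the block-scale smallness `2d³(L^{2k}·max‖u(∂p) − 1‖)² ≤ 1` — p11's covariant multiscale Poincaré inequality `massBound_small`.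
(ii) For a weight `ω` with the oscillation bounds of `BIJ85AgmonDefect` (`S₁` across bonds, `S₂` inside blocks) the conjugation defect of `T`
is `κ = 2dc²S₁ + aS₂/(2N)`; if `κ < m₀` then for `φ = Gh`: `(m₀ − κ)‖ωφ‖² ≤ ⟨ωφ,Tωφ⟩ − κ‖ωφ‖² ≤ ⟨Tφ, ω²φ⟩ = ⟨ωh, ωφ⟩ ≤ ‖ωh‖‖ωφ‖`, i.e.
**`‖ωGh‖ ≤ ‖ωh‖/(m₀ − κ)`** (`agmon_weighted`).  (iii) With `ω = e^{ρ}`, `ρ = 0` on `supp h`, `ρ ≥ R` on `supp h′`: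
**`|⟨h′, Gh⟩| = |⟨ω⁻¹h′, ωGh⟩| ≤ e^{−R}‖h′‖‖h‖/(m₀ − κ)`** (`decay_pairing`).  (iv) The geometric weight `ρ = t·dist_∞(·, supp h)/L^k`
(`distTo`, the one definition of this file; `ℓ^∞` torus distance of record `LatticeFieldCalculus.supDist`) has `|ρ(b₊) − ρ(b₋)| ≤ t/L^k` and
oscillation `≤ t` inside `k`-blocks, whence **`decay_pairing_dist`**: `|⟨h′, Gh⟩| ≤ e^{−tD/L^k}‖h′‖‖h‖/(m₀ − κ(t))` for `h′` supported at
`ℓ^∞`-distance `≥ D` (η-steps) from `supp h`, `κ(t) = 2dc²(t/n)²e^{t/n} + a·t²e^t/(2N)`.  The physical normalization `c² = n²/N` (rate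
`t₀(d, a)`, constant `2N/min(a/2, 1/4)`, uniform in `k`, volume, `u`) and the (7.3.1) corollary for the ACTUAL background (4.5.4) are file 3,
`BIJ85Claim73PropagatorDecay`.
HONEST SCOPE.  Decay member only (no pointwise / Hölder regularity member of [7]); `L²` pairing form; general `(c, a)` here; constants ours and
explicit; `U = U(1)` fields on the torus carriers of record, standing range `j + k ≤ m + K`.  Nothing here is summit progress.  Unit
`lit-balaban-p33` (literature-prover-lit-balaban-p33-g8-0), HOME `run/shared/lean/pub/lit-balaban/`, 2026-08-21.
-/

open scoped RealInnerProductSpace BigOperators ComplexConjugate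
open Finset

namespace Literature.MathematicalPhysics.QuantumFieldTheory.BalabanImbrieJaffe1984to88.BIJ85ScalarPropagatorDecay

open Literature.MathematicalPhysics.QuantumFieldTheory.Balaban1983to89
open BIJ88Sect3Statements (U1 toC toC_one toC_mul norm_toC cfg covD)
open BIJ85Sect1Model (HiggsField)
open BIJ85BlockAveragesTorus BIJ85BlockAveragesTorusK BIJ85ScalarPropagatorTorus BIJ85ScalarPropagatorTorusK
open BIJ85ScalarForm464 BIJ85Eq461Proof BIJ85BlockAveragingIneq BIJ85Ineq732Flat BIJ85Ineq732General
open BIJ85AbelianStokes (plaqC)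
open BIJ85CovariantPoincare (massBound_small)
open BIJ85Ineq732PullBack (norm_Dlin_sq')
open BIJ85AgmonDefect
open LatticeFieldCalculus (supDist)
open BIJ85BlockKPoincare (val_blkIter)
open BIJ85Ineq722Torus (supDist_triangle supDist_runSite_le)
open B3TorusRadialSums (supDist_comm supDist_eq_zero_iff)

noncomputable section

variable {P : Params} {j : ℕ}

/-! ## §4 Coercivity of `D_u^*D_u + aQ_k(u)^*Q_k(u)` from the covariant Poincaré inequality -/

/-- **Coercivity**: under the block-scale plaquette smallness `2d³(L^{2k}θ)² ≤ 1` (`θ = max‖u(∂p) − 1‖`), for every `φ`,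
`m₀‖φ‖² ≤ ⟨φ, (D_u^*D_u + aQ_k(u)^*Q_k(u))φ⟩` with `m₀ = min(a/2, c²N/(4n²))/N` (`n = L^k`, `N = L^{kd}`) — p11's covariant multiscale
Poincaré inequality `BIJ85CovariantPoincare.massBound_small` read on the form of (4.6.2). [cite: BalabanImbrieJaffe1985, (4.6.2) p.313] -/
theorem coercive_opT {k : ℕ} (hk : j + k ≤ P.m + P.K) (c : ℝ) {a : ℝ} (ha : 0 < a) (U : GaugeField P j U1) {θ : ℝ}
    (hθ : ∀ (x : Balaban1983to89.Site P j) (μ ν : Fin P.d), ‖plaqC U x μ ν - 1‖ ≤ θ)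
    (hsmall : 2 * (P.d : ℝ) ^ 3 * (((P.L : ℝ) ^ k) ^ 2 * θ) ^ 2 ≤ 1) (φ : FineSp P j) :
    min (a / 2) (c ^ 2 * (P.L : ℝ) ^ (k * P.d) / (4 * ((P.L : ℝ) ^ k) ^ 2)) / (P.L : ℝ) ^ (k * P.d) * ‖φ‖ ^ 2
      ≤ ⟪φ, opT (Dlin c U) (QlinK U k) a φ⟫ := by
  have hN : (0 : ℝ) < (P.L : ℝ) ^ (k * P.d) := pow_pos P.cast_L_pos _
  have hn : (0 : ℝ) < ((P.L : ℝ) ^ k) ^ 2 := pow_pos (pow_pos P.cast_L_pos _) _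
  have hm := massBound_small hk U hθ hsmall (WithLp.ofLp φ)
  rw [sum_norm_sq_eq, ← norm_QlinK_sq] at hm
  rw [inner_opT]
  set S := ‖φ‖ ^ 2
  set Qn := ‖QlinK U k φ‖ ^ 2
  set E := ∑ b : PBond P j, ‖toC (U b) * (WithLp.ofLp φ) b.tgt - (WithLp.ofLp φ) b.src‖ ^ 2 with hE
  have hD : ‖Dlin c U φ‖ ^ 2 = c ^ 2 * E := norm_Dlin_sq' c U φ
  have hE0 : 0 ≤ E := Finset.sum_nonneg fun _ _ => by positivity
  have hQ0 : 0 ≤ Qn := by positivity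
  set m' := min (a / 2) (c ^ 2 * (P.L : ℝ) ^ (k * P.d) / (4 * ((P.L : ℝ) ^ k) ^ 2)) with hm'
  have h1 : m' * (2 * Qn) ≤ a * Qn := by
    have := min_le_left (a / 2) (c ^ 2 * (P.L : ℝ) ^ (k * P.d) / (4 * ((P.L : ℝ) ^ k) ^ 2)); nlinarith
  have h2 : m' * (4 * ((P.L : ℝ) ^ k) ^ 2 * ((P.L : ℝ) ^ (k * P.d))⁻¹ * E) ≤ c ^ 2 * E := by
    have hle := min_le_right (a / 2) (c ^ 2 * (P.L : ℝ) ^ (k * P.d) / (4 * ((P.L : ℝ) ^ k) ^ 2))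
    have hx : 0 ≤ 4 * ((P.L : ℝ) ^ k) ^ 2 * ((P.L : ℝ) ^ (k * P.d))⁻¹ * E := by positivity
    calc m' * (4 * ((P.L : ℝ) ^ k) ^ 2 * ((P.L : ℝ) ^ (k * P.d))⁻¹ * E)
        ≤ (c ^ 2 * (P.L : ℝ) ^ (k * P.d) / (4 * ((P.L : ℝ) ^ k) ^ 2)) * (4 * ((P.L : ℝ) ^ k) ^ 2 * ((P.L : ℝ) ^ (k * P.d))⁻¹ * E) :=
          mul_le_mul_of_nonneg_right hle hx
      _ = c ^ 2 * E := by
          have hL : (P.L : ℝ) ^ k ≠ 0 := (pow_pos P.cast_L_pos _).ne'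
          field_simp
  have hm0 : 0 ≤ m' := le_min (by linarith) (by positivity)
  calc m' / (P.L : ℝ) ^ (k * P.d) * S = m' * (((P.L : ℝ) ^ (k * P.d))⁻¹ * S) := by ring
    _ ≤ m' * (2 * Qn + 4 * ((P.L : ℝ) ^ k) ^ 2 * ((P.L : ℝ) ^ (k * P.d))⁻¹ * E) := mul_le_mul_of_nonneg_left hm hm0
    _ = m' * (2 * Qn) + m' * (4 * ((P.L : ℝ) ^ k) ^ 2 * ((P.L : ℝ) ^ (k * P.d))⁻¹ * E) := by ring
    _ ≤ a * Qn + c ^ 2 * E := add_le_add h1 h2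
    _ = ‖Dlin c U φ‖ ^ 2 + a * Qn := by rw [hD]; ring

/-! ## §5 The Agmon estimate: weighted resolvent bound -/

/-- kernel: the bilinear form of `T = D^*D + aQ^*Q` of (4.6.2): `⟨Tf, g⟩ = ⟨Df, Dg⟩ + a⟨Qf, Qg⟩`. [cite: BalabanImbrieJaffe1985, (4.6.2) p.313] -/
theorem inner_opT_left {k : ℕ} (c a : ℝ) (U : GaugeField P j U1) (f g : FineSp P j) :
    ⟪opT (Dlin c U) (QlinK U k) a f, g⟫ = ⟪Dlin c U f, Dlin c U g⟫ + a * ⟪QlinK U k f, QlinK U k g⟫ := by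
  simp only [opT, LinearMap.add_apply, LinearMap.smul_apply, LinearMap.coe_comp, Function.comp_apply, inner_add_left,
    real_inner_smul_left, LinearMap.adjoint_inner_left]

/-- **THE AGMON–COMBES–THOMAS WEIGHTED BOUND** for `G = [D_u^*D_u + aQ_k(u)^*Q_k(u)]⁻¹` (any right inverse `G`): for every weight
`ω` whose squared oscillation is `S₁`-small across η-bonds and `S₂`-small inside `k`-blocks (relative to `ωω′`), with
`κ = 2dc²S₁ + a·S₂/(2N) < m₀`, and every source `h`: `‖ωGh‖ ≤ ‖ωh‖/(m₀ − κ)` — five lines: coercivity at `ωGh`, the two conjugation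
defects of `BIJ85AgmonDefect`, the equation `T(Gh) = h` tested against `ω²Gh`, Cauchy–Schwarz. [cite: BalabanImbrieJaffe1985, (7.3.2) p.326] -/
theorem agmon_weighted {k : ℕ} (hk : j + k ≤ P.m + P.K) (c : ℝ) {a : ℝ} (ha : 0 < a) (U : GaugeField P j U1) {θ : ℝ}
    (hθ : ∀ (x : Balaban1983to89.Site P j) (μ ν : Fin P.d), ‖plaqC U x μ ν - 1‖ ≤ θ)
    (hsmall : 2 * (P.d : ℝ) ^ 3 * (((P.L : ℝ) ^ k) ^ 2 * θ) ^ 2 ≤ 1)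
    {ω : Balaban1983to89.Site P j → ℝ} {S₁ S₂ : ℝ} (hS₁ : 0 ≤ S₁) (hS₂ : 0 ≤ S₂)
    (hω₁ : ∀ b : PBond P j, (ω b.tgt - ω b.src) ^ 2 ≤ S₁ * (ω b.tgt * ω b.src))
    (hω₂ : ∀ x x' : Balaban1983to89.Site P j, blkIter k x = blkIter k x' → (ω x - ω x') ^ 2 ≤ S₂ * (ω x * ω x'))
    (hκ : 2 * P.d * c ^ 2 * S₁ + a * (S₂ / 2 * ((P.L : ℝ) ^ (k * P.d))⁻¹)
      < min (a / 2) (c ^ 2 * (P.L : ℝ) ^ (k * P.d) / (4 * ((P.L : ℝ) ^ k) ^ 2)) / (P.L : ℝ) ^ (k * P.d))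
    {G : FineSp P j →ₗ[ℝ] FineSp P j} (hG : ∀ φ, opT (Dlin c U) (QlinK U k) a (G φ) = φ) (h : FineSp P j) :
    ‖wmul ω (G h)‖ ≤ ‖wmul ω h‖ /
      (min (a / 2) (c ^ 2 * (P.L : ℝ) ^ (k * P.d) / (4 * ((P.L : ℝ) ^ k) ^ 2)) / (P.L : ℝ) ^ (k * P.d)
        - (2 * P.d * c ^ 2 * S₁ + a * (S₂ / 2 * ((P.L : ℝ) ^ (k * P.d))⁻¹))) := by
  set m₀ := min (a / 2) (c ^ 2 * (P.L : ℝ) ^ (k * P.d) / (4 * ((P.L : ℝ) ^ k) ^ 2)) / (P.L : ℝ) ^ (k * P.d) with hm₀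
  set κ := 2 * P.d * c ^ 2 * S₁ + a * (S₂ / 2 * ((P.L : ℝ) ^ (k * P.d))⁻¹) with hκdef
  set φ := G h with hφ
  have hpos : 0 < m₀ - κ := sub_pos.2 hκ
  -- (1) coercivity at the weighted field
  have h1 : m₀ * ‖wmul ω φ‖ ^ 2 ≤ ‖Dlin c U (wmul ω φ)‖ ^ 2 + a * ‖QlinK U k (wmul ω φ)‖ ^ 2 := by
    rw [← inner_opT]; exact coercive_opT hk c ha U hθ hsmall _
  -- (2) the two conjugation defects
  have h2 := defect_D_le c U hS₁ hω₁ φ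
  have h3 := mul_le_mul_of_nonneg_left (defect_Q_le hk U hS₂ hω₂ φ) ha.le
  -- (3) the weak equation tested against ω²φ
  have h4 : ⟪Dlin c U φ, Dlin c U (wmul ω (wmul ω φ))⟫ + a * ⟪QlinK U k φ, QlinK U k (wmul ω (wmul ω φ))⟫
      ≤ ‖wmul ω h‖ * ‖wmul ω φ‖ := by
    rw [← inner_opT_left, hφ, hG, ← inner_wmul_comm]
    exact real_inner_le_norm _ _
  -- (4) assemble
  have h5 : (m₀ - κ) * ‖wmul ω φ‖ ^ 2 ≤ ‖wmul ω h‖ * ‖wmul ω φ‖ := by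
    rw [hκdef]; nlinarith [h1, h2, h3, h4]
  rw [le_div_iff₀ hpos]
  by_cases hz : ‖wmul ω φ‖ = 0
  · rw [hz, zero_mul]; exact norm_nonneg _
  · have hp : 0 < ‖wmul ω φ‖ := (norm_nonneg _).lt_of_ne (Ne.symm hz)
    nlinarith


/-! ## §6 Exponential weights and the decay of the pairing `⟨h′, G h⟩` -/

/-- kernel: `⟨ω⁻¹h′, ωφ⟩ = ⟨h′, φ⟩` for a nowhere-vanishing weight. [cite: BalabanImbrieJaffe1985, (2.2) p.302] -/
theorem inner_wmul_inv_wmul {ω : Balaban1983to89.Site P j → ℝ} (hω : ∀ x, ω x ≠ 0) (h' φ : FineSp P j) :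
    ⟪wmul (fun x => (ω x)⁻¹) h', wmul ω φ⟫ = ⟪h', φ⟫ := by
  rw [inner_wmul_comm, wmul_wmul]
  have : (fun x => (ω x)⁻¹ * ω x) = fun _ => (1 : ℝ) := funext fun x => inv_mul_cancel₀ (hω x)
  rw [this, wmul_one']

/-- kernel: a weight equal to `1` on the support does not change the `ℓ²` norm. [cite: BalabanImbrieJaffe1985, (2.2) p.302] -/
theorem norm_wmul_exp_eq {ρ : Balaban1983to89.Site P j → ℝ} {h : FineSp P j} (hh : ∀ x, h x ≠ 0 → ρ x = 0) :
    ‖wmul (fun x => Real.exp (ρ x)) h‖ = ‖h‖ := by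
  have h2 : ‖wmul (fun x => Real.exp (ρ x)) h‖ ^ 2 = ‖h‖ ^ 2 := by
    rw [norm_wmul_sq, ← sum_norm_sq_eq]
    refine Finset.sum_congr rfl fun x _ => ?_
    by_cases hx : h x = 0
    · simp [hx]
    · rw [hh x hx, Real.exp_zero, one_mul]
  have h0 := norm_nonneg (wmul (fun x => Real.exp (ρ x)) h)
  have h1 := norm_nonneg h
  nlinarith [sq_nonneg (‖wmul (fun x => Real.exp (ρ x)) h‖ - ‖h‖), sq_nonneg (‖wmul (fun x => Real.exp (ρ x)) h‖ + ‖h‖)]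

/-- kernel: the inverse weight `e^{−ρ}` on a support where `ρ ≥ R` costs `e^{−R}` in the `ℓ²` norm. [cite: BalabanImbrieJaffe1985, (2.2) p.302] -/
theorem norm_wmul_exp_inv_le {ρ : Balaban1983to89.Site P j → ℝ} {h' : FineSp P j} {R : ℝ} (hh' : ∀ x, h' x ≠ 0 → R ≤ ρ x) :
    ‖wmul (fun x => (Real.exp (ρ x))⁻¹) h'‖ ≤ Real.exp (-R) * ‖h'‖ := by
  refine norm_wmul_le (Real.exp_pos _).le h' fun x hx => ?_
  rw [abs_of_pos (inv_pos.2 (Real.exp_pos _)), ← Real.exp_neg]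
  exact Real.exp_le_exp.2 (neg_le_neg (hh' x hx))

/-- **EXPONENTIAL DECAY OF THE PAIRING, ABSTRACT WEIGHT**: for `G = [D_u^*D_u + aQ_k(u)^*Q_k(u)]⁻¹` (any right inverse), a background
with `2d³(L^{2k}θ)² ≤ 1`, and ANY `ρ : T → ℝ` with `|ρ(b₊) − ρ(b₋)| ≤ δ₁` on η-bonds and `|ρ(x) − ρ(x′)| ≤ δ₂` inside `k`-blocks such that
`κ = 2dc²δ₁²e^{δ₁} + a·δ₂²e^{δ₂}/(2N) < m₀`: if `h` is supported in `{ρ = 0}` and `h′` in `{ρ ≥ R}` then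
`|⟨h′, Gh⟩| ≤ e^{−R}‖h′‖‖h‖/(m₀ − κ)` — the shape of [7] Cor. 2.3 (2.30) for the torus operator of record, by the energy route.
[cite: BalabanImbrieJaffe1985, (7.3.2) p.326] -/
theorem decay_pairing {k : ℕ} (hk : j + k ≤ P.m + P.K) (c : ℝ) {a : ℝ} (ha : 0 < a) (U : GaugeField P j U1) {θ : ℝ}
    (hθ : ∀ (x : Balaban1983to89.Site P j) (μ ν : Fin P.d), ‖plaqC U x μ ν - 1‖ ≤ θ)
    (hsmall : 2 * (P.d : ℝ) ^ 3 * (((P.L : ℝ) ^ k) ^ 2 * θ) ^ 2 ≤ 1)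
    {ρ : Balaban1983to89.Site P j → ℝ} {δ₁ δ₂ : ℝ}
    (hρ₁ : ∀ b : PBond P j, |ρ b.tgt - ρ b.src| ≤ δ₁)
    (hρ₂ : ∀ x x' : Balaban1983to89.Site P j, blkIter k x = blkIter k x' → |ρ x - ρ x'| ≤ δ₂)
    (hκ : 2 * P.d * c ^ 2 * (δ₁ ^ 2 * Real.exp δ₁) + a * (δ₂ ^ 2 * Real.exp δ₂ / 2 * ((P.L : ℝ) ^ (k * P.d))⁻¹)
      < min (a / 2) (c ^ 2 * (P.L : ℝ) ^ (k * P.d) / (4 * ((P.L : ℝ) ^ k) ^ 2)) / (P.L : ℝ) ^ (k * P.d))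
    {G : FineSp P j →ₗ[ℝ] FineSp P j} (hG : ∀ φ, opT (Dlin c U) (QlinK U k) a (G φ) = φ)
    {h h' : FineSp P j} {R : ℝ} (hh : ∀ x, h x ≠ 0 → ρ x = 0) (hh' : ∀ x, h' x ≠ 0 → R ≤ ρ x) :
    |⟪h', G h⟫| ≤ Real.exp (-R) * ‖h'‖ * ‖h‖ /
      (min (a / 2) (c ^ 2 * (P.L : ℝ) ^ (k * P.d) / (4 * ((P.L : ℝ) ^ k) ^ 2)) / (P.L : ℝ) ^ (k * P.d)
        - (2 * P.d * c ^ 2 * (δ₁ ^ 2 * Real.exp δ₁) + a * (δ₂ ^ 2 * Real.exp δ₂ / 2 * ((P.L : ℝ) ^ (k * P.d))⁻¹))) := by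
  set ω : Balaban1983to89.Site P j → ℝ := fun x => Real.exp (ρ x) with hω
  have hωpos : ∀ x, 0 < ω x := fun x => Real.exp_pos _
  have hω₁ : ∀ b : PBond P j, (ω b.tgt - ω b.src) ^ 2 ≤ δ₁ ^ 2 * Real.exp δ₁ * (ω b.tgt * ω b.src) :=
    fun b => sq_exp_sub_exp_le_of_abs_le (hρ₁ b)
  have hω₂ : ∀ x x' : Balaban1983to89.Site P j, blkIter k x = blkIter k x' →
      (ω x - ω x') ^ 2 ≤ δ₂ ^ 2 * Real.exp δ₂ * (ω x * ω x') :=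
    fun x x' hxx' => sq_exp_sub_exp_le_of_abs_le (hρ₂ x x' hxx')
  have hpos := sub_pos.2 hκ
  have hA := agmon_weighted hk c ha U hθ hsmall (by positivity) (by positivity) hω₁ hω₂ hκ hG h
  rw [← inner_wmul_inv_wmul (fun x => (hωpos x).ne') h' (G h)]
  have hB := norm_wmul_exp_inv_le (h' := h') hh'
  have hC := norm_wmul_exp_eq (h := h) hh
  calc |⟪wmul (fun x => (ω x)⁻¹) h', wmul ω (G h)⟫|
      ≤ ‖wmul (fun x => (ω x)⁻¹) h'‖ * ‖wmul ω (G h)‖ := abs_real_inner_le_norm _ _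
    _ ≤ (Real.exp (-R) * ‖h'‖) * (‖wmul ω h‖ / _) := mul_le_mul hB hA (norm_nonneg _) (by positivity)
    _ = _ := by rw [hC]; ring


/-! ## §7 The geometric weight: `ℓ^∞` distance to the support of the source, in units of the block -/

/-- kernel: an η-bond has `ℓ^∞` length `≤ 1`: `|b₋ − b₊|_∞ ≤ 1`. [cite: BalabanImbrieJaffe1985, (2.1) p.302] -/
theorem supDist_src_tgt_le (b : PBond P j) : supDist b.src b.tgt ≤ 1 := by
  have h := supDist_runSite_le b.src b.dir 1
  have h2 : LatticeFieldCalculus.runSite b.src b.dir 1 = b.tgt := by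
    show Function.update b.src b.dir (b.src b.dir + ((1 : ℕ) : ZMod _)) = Function.update b.src b.dir (b.src b.dir + 1)
    rw [Nat.cast_one]
  rwa [h2] at h

/-- kernel: two sites of the same `k`-block `B^k(y)` ((2.4) iterated) are at `ℓ^∞` distance `≤ L^k − 1` (labels with the same integer
quotient by `L^k`). [cite: BalabanImbrieJaffe1985, (2.4) p.302] -/
theorem supDist_le_of_blkIter_eq {k : ℕ} (hk : j + k ≤ P.m + P.K) {x x' : Balaban1983to89.Site P j}
    (h : blkIter k x = blkIter k x') : supDist x x' ≤ P.L ^ k - 1 := by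
  unfold supDist
  refine Finset.sup_le fun κ _ => ?_
  have hq : (x κ).val / P.L ^ k = (x' κ).val / P.L ^ k := by
    rw [← val_blkIter k hk x κ, ← val_blkIter k hk x' κ, h]
  have hn := pow_pos P.L_pos k
  have key : ∀ m m' : ZMod (P.sitesPerDir j), m.val / P.L ^ k = m'.val / P.L ^ k → m'.val ≤ m.val →
      (m - m').val ≤ P.L ^ k - 1 := by
    intro m m' hmm' hle
    rw [ZMod.val_sub hle]
    have h1 : m.val = P.L ^ k * (m.val / P.L ^ k) + m.val % P.L ^ k := (Nat.div_add_mod _ _).symm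
    have h2 : m'.val = P.L ^ k * (m'.val / P.L ^ k) + m'.val % P.L ^ k := (Nat.div_add_mod _ _).symm
    have h3 : m.val % P.L ^ k < P.L ^ k := Nat.mod_lt _ hn
    rw [hmm'] at h1
    generalize P.L ^ k * (m'.val / P.L ^ k) = A at h1 h2
    generalize P.L ^ k = q at h1 h2 h3 ⊢
    omega
  rcases le_total (x' κ).val (x κ).val with hle | hle
  · exact (min_le_left _ _).trans (key _ _ hq hle)
  · exact (min_le_right _ _).trans (key _ _ hq.symm hle)

/-- **`dist_∞(x, X)`**: the `ℓ^∞` torus distance (in η-lattice steps, `LatticeFieldCalculus.supDist`) from a site to a finite set of sites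
(`0` for the empty set) — the `dist(supp f, supp f′)` of [7] (2.30) for the decay of the propagators of p. 326. [cite: BalabanImbrieJaffe1985, (7.3.2) p.326] -/
def distTo (X : Finset (Balaban1983to89.Site P j)) (x : Balaban1983to89.Site P j) : ℕ :=
  if hX : X.Nonempty then X.inf' hX (fun x₀ => supDist x x₀) else 0

/-- kernel: the distance to `X` vanishes on `X`. [cite: BalabanImbrieJaffe1985, (7.3.2) p.326] -/
theorem distTo_eq_zero_of_mem {X : Finset (Balaban1983to89.Site P j)} {x : Balaban1983to89.Site P j} (hx : x ∈ X) :
    distTo X x = 0 := by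
  have hX : X.Nonempty := ⟨x, hx⟩
  rw [distTo, dif_pos hX]
  have h := Finset.inf'_le (fun x₀ => supDist x x₀) hx
  rw [(supDist_eq_zero_iff x x).2 rfl] at h
  exact Nat.le_zero.1 h

/-- kernel: the distance to a single site is the `ℓ^∞` torus distance to it. [cite: BalabanImbrieJaffe1985, (7.3.2) p.326] -/
theorem distTo_singleton (y x : Balaban1983to89.Site P j) : distTo {y} x = supDist x y := by
  rw [distTo, dif_pos (Finset.singleton_nonempty y), Finset.inf'_singleton]

/-- kernel: the distance to `X` is `1`-Lipschitz for the `ℓ^∞` torus distance (triangle inequality). [cite: BalabanImbrieJaffe1985, (7.3.2) p.326] -/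
theorem distTo_le_distTo_add {X : Finset (Balaban1983to89.Site P j)} (x x' : Balaban1983to89.Site P j) :
    distTo X x ≤ distTo X x' + supDist x x' := by
  by_cases hX : X.Nonempty
  · rw [distTo, distTo, dif_pos hX, dif_pos hX]
    obtain ⟨x₀, hx₀, hmin⟩ := Finset.exists_mem_eq_inf' hX (fun x₁ => supDist x' x₁)
    rw [hmin]
    calc X.inf' hX (fun x₁ => supDist x x₁) ≤ supDist x x₀ := Finset.inf'_le _ hx₀
      _ ≤ supDist x x' + supDist x' x₀ := supDist_triangle x x' x₀
      _ = supDist x' x₀ + supDist x x' := add_comm _ _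
  · rw [distTo, distTo, dif_neg hX, dif_neg hX]; exact Nat.zero_le _

/-- kernel: `|dist_∞(x, X) − dist_∞(x′, X)| ≤ |x − x′|_∞` (as reals). [cite: BalabanImbrieJaffe1985, (7.3.2) p.326] -/
theorem abs_distTo_sub_le {X : Finset (Balaban1983to89.Site P j)} (x x' : Balaban1983to89.Site P j) :
    |(distTo X x : ℝ) - distTo X x'| ≤ supDist x x' := by
  have h1 := distTo_le_distTo_add (X := X) x x'
  have h2 := distTo_le_distTo_add (X := X) x' x
  rw [supDist_comm x' x] at h2
  rw [abs_le]
  constructor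
  · have : (distTo X x' : ℝ) ≤ distTo X x + supDist x x' := by exact_mod_cast h2
    linarith
  · have : (distTo X x : ℝ) ≤ distTo X x' + supDist x x' := by exact_mod_cast h1
    linarith

/-- **EXPONENTIAL DECAY OF `G = [D_u^*D_u + aQ_k(u)^*Q_k(u)]⁻¹` IN THE BLOCK DISTANCE BETWEEN THE SUPPORTS** (general normalization `c`,
general rate `t`): with the weight `ρ = t·dist_∞(·, X)/L^k`, if `h` is supported in `X` and `h′` at `ℓ^∞`-distance `≥ D` (η-steps) from `X`,
and `κ(t) = 2dc²(t/n)²e^{t/n} + a·t²e^t/(2N) < m₀` (`n = L^k`), then `|⟨h′, Gh⟩| ≤ e^{−tD/L^k}‖h′‖‖h‖/(m₀ − κ(t))` — for EVERY `U(1)`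
background with `2d³(L^{2k}θ)² ≤ 1`, every `t ≥ 0`, `j + k ≤ m + K`. [cite: BalabanImbrieJaffe1985, (7.3.2) p.326] -/
theorem decay_pairing_dist {k : ℕ} (hk : j + k ≤ P.m + P.K) (c : ℝ) {a : ℝ} (ha : 0 < a) (U : GaugeField P j U1) {θ : ℝ}
    (hθ : ∀ (x : Balaban1983to89.Site P j) (μ ν : Fin P.d), ‖plaqC U x μ ν - 1‖ ≤ θ)
    (hsmall : 2 * (P.d : ℝ) ^ 3 * (((P.L : ℝ) ^ k) ^ 2 * θ) ^ 2 ≤ 1) {t : ℝ} (ht : 0 ≤ t)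
    (hκ : 2 * P.d * c ^ 2 * ((t / (P.L : ℝ) ^ k) ^ 2 * Real.exp (t / (P.L : ℝ) ^ k))
        + a * (t ^ 2 * Real.exp t / 2 * ((P.L : ℝ) ^ (k * P.d))⁻¹)
      < min (a / 2) (c ^ 2 * (P.L : ℝ) ^ (k * P.d) / (4 * ((P.L : ℝ) ^ k) ^ 2)) / (P.L : ℝ) ^ (k * P.d))
    {G : FineSp P j →ₗ[ℝ] FineSp P j} (hG : ∀ φ, opT (Dlin c U) (QlinK U k) a (G φ) = φ)
    (X : Finset (Balaban1983to89.Site P j)) {h h' : FineSp P j} (hh : ∀ x, h x ≠ 0 → x ∈ X) {D : ℕ}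
    (hh' : ∀ x, h' x ≠ 0 → D ≤ distTo X x) :
    |⟪h', G h⟫| ≤ Real.exp (-(t * D / (P.L : ℝ) ^ k)) * ‖h'‖ * ‖h‖ /
      (min (a / 2) (c ^ 2 * (P.L : ℝ) ^ (k * P.d) / (4 * ((P.L : ℝ) ^ k) ^ 2)) / (P.L : ℝ) ^ (k * P.d)
        - (2 * P.d * c ^ 2 * ((t / (P.L : ℝ) ^ k) ^ 2 * Real.exp (t / (P.L : ℝ) ^ k))
            + a * (t ^ 2 * Real.exp t / 2 * ((P.L : ℝ) ^ (k * P.d))⁻¹))) := by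
  have hn : (0 : ℝ) < (P.L : ℝ) ^ k := pow_pos P.cast_L_pos _
  have hn1 : (1 : ℝ) ≤ (P.L : ℝ) ^ k := one_le_pow₀ (by exact_mod_cast P.L_pos)
  set ρ : Balaban1983to89.Site P j → ℝ := fun x => t * (distTo X x : ℝ) / (P.L : ℝ) ^ k with hρ
  have hρ₁ : ∀ b : PBond P j, |ρ b.tgt - ρ b.src| ≤ t / (P.L : ℝ) ^ k := by
    intro b
    have h1 := abs_distTo_sub_le (X := X) b.tgt b.src
    have h2 : (supDist b.tgt b.src : ℝ) ≤ 1 := by rw [supDist_comm]; exact_mod_cast supDist_src_tgt_le b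
    have e : ρ b.tgt - ρ b.src = t / (P.L : ℝ) ^ k * ((distTo X b.tgt : ℝ) - distTo X b.src) := by rw [hρ]; ring
    rw [e, abs_mul, abs_of_nonneg (div_nonneg ht hn.le)]
    calc t / (P.L : ℝ) ^ k * |(distTo X b.tgt : ℝ) - distTo X b.src| ≤ t / (P.L : ℝ) ^ k * 1 :=
          mul_le_mul_of_nonneg_left (h1.trans h2) (div_nonneg ht hn.le)
      _ = _ := mul_one _
  have hρ₂ : ∀ x x' : Balaban1983to89.Site P j, blkIter k x = blkIter k x' → |ρ x - ρ x'| ≤ t := by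
    intro x x' hxx'
    have h1 := abs_distTo_sub_le (X := X) x x'
    have h2 : (supDist x x' : ℝ) ≤ (P.L : ℝ) ^ k := by
      have h3 := supDist_le_of_blkIter_eq hk hxx'
      have h4 : ((P.L ^ k - 1 : ℕ) : ℝ) ≤ (P.L : ℝ) ^ k := by
        rw [Nat.cast_sub (Nat.one_le_pow _ _ P.L_pos), Nat.cast_pow, Nat.cast_one]; linarith
      exact (Nat.cast_le.2 h3).trans h4
    have e : ρ x - ρ x' = t / (P.L : ℝ) ^ k * ((distTo X x : ℝ) - distTo X x') := by rw [hρ]; ring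
    rw [e, abs_mul, abs_of_nonneg (div_nonneg ht hn.le)]
    calc t / (P.L : ℝ) ^ k * |(distTo X x : ℝ) - distTo X x'| ≤ t / (P.L : ℝ) ^ k * (P.L : ℝ) ^ k :=
          mul_le_mul_of_nonneg_left (h1.trans h2) (div_nonneg ht hn.le)
      _ = t := div_mul_cancel₀ _ hn.ne'
  have hhρ : ∀ x, h x ≠ 0 → ρ x = 0 := by
    intro x hx; rw [hρ]; simp [distTo_eq_zero_of_mem (hh x hx)]
  have hh'ρ : ∀ x, h' x ≠ 0 → t * D / (P.L : ℝ) ^ k ≤ ρ x := by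
    intro x hx
    rw [hρ]
    exact div_le_div_of_nonneg_right (mul_le_mul_of_nonneg_left (by exact_mod_cast hh' x hx) ht) hn.le
  exact decay_pairing hk c ha U hθ hsmall hρ₁ hρ₂ hκ hG hhρ hh'ρ

end

end Literature.MathematicalPhysics.QuantumFieldTheory.BalabanImbrieJaffe1984to88.BIJ85ScalarPropagatorDecay
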